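import Mathlib
import HarnessLib.Audit
import Summits.PneNP.PneNP.Theorems.PstarLiteralPinningCriterion
import Summits.PneNP.PneNP.Theorems.PstarMenuRelease

/-!
# Release gates of an exact certificate: forced released form, and the one-block join behind them (ROUND-24, O1; memo g27 §71)

FRONTIER range-avoidance ladder, rung F-N3, ROUND 24 (cell `pnp-ideate`, prover-2 memo `g27/O1-PINNING-g27.md` §71; census node
`PstarLocalGateBudgetAssembly.LocalMenuCriterionBoundGateBudget`; restricted-model proof complexity — nothing here bears on `P` versus `NP`).

The census rule for DECORATIONS in final form.  A terminal pair `(K; Γ₁, Γ₂)` (`PstarCoreBoundTargets.Terminal`), a monomial `g` of `Γ₂` (not of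
`Γ₁`) with AND pair `{s, π}` HALF-FREE at `π` (`π` in no output of `K`, in no other monomial, `π ∉ C₁`) — a connector / release gate of the
committed menu on a chord outside the certificate.  `PstarHalfFreeGate.sigma_eq_of_halfFree` pins `x_s ≡ [π ∈ C₂]` on the slice; the block-join
criterion (`PstarLiteralPinning`, `PstarLiteralPinningCriterion`) turns this into combinatorics:

* **`mem_linear_of_release`** — if the partners of `s` are private (`σ`- and `π`-type literals of the planner's structures), then `π ∈ C₂`: only the
  RELEASED form `x_s x_π ⊕ x_π = (x_s ⊕ 1)·x_π` can be transparent, never the bare gate;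
* **`block_join_of_release`** — and (typed instance, `C₁` off the AND variables, every output with a private AND variable) there is a ONE-BLOCK
  JOIN THROUGH `s` OF VALUE `1` (`IsJoin`, `joinValue`): on a cycle core an arc-with-all-folds inside `s`'s block, of value one;
* **`block_join_of_release_private`** — a release on a literal `p` PRIVATE to a member `t ∈ K` forces the same for the shared literal `s_t` of `t`
  (via `PstarSliceConstancy.literal_true_of_private_constant`);
* **`terminal_release_of_block_join`** — conversely (`PstarMenuRelease.terminal_release_true`): over a one-block value-one join through `s`, the
  released gate `(s, π) + π` on a fresh `π` keeps the pair terminal.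

So, for all `k`: a decoration `(s, π_d)` of a certificate is admissible iff it is released (`π_d` read linearly) and `s` (or the shared literal of
`s`'s member, for private `s`) carries a one-block value-one join — p3's RELAX=2 column, now a join enumeration.
-/

set_option linter.dupNamespace false -- `Summit.PneNP.PneNP.…`: summit = sub-problem name (D-0017 single-conjunct layout)

open Finset Literature.Computability.Complexity
open Summit.PneNP.PneNP.Theorems.PstarTyped (Typed)
open Summit.PneNP.PneNP.Theorems.PstarSALevel (varSet BoundaryExpanding SimpleOverlap)
open Summit.PneNP.PneNP.Theorems.PstarGapOneAll (gval)
open Summit.PneNP.PneNP.Theorems.PstarCoreBoundTargets (Terminal)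
open Summit.PneNP.PneNP.Theorems.PstarMenuLocality (exists_sol_on_target₁)
open Summit.PneNP.PneNP.Theorems.PstarHalfFreeGate (sigma_eq_of_halfFree)
open Summit.PneNP.PneNP.Theorems.PstarSliceConstancy (literal_true_of_private_constant)
open Summit.PneNP.PneNP.Theorems.PstarMenuRelease (terminal_release_true)
open Summit.PneNP.PneNP.Theorems.PstarLiteralPinning (Through InSlice IsJoin joinValue true_of_block_join)
open Summit.PneNP.PneNP.Theorems.PstarLiteralPinningCriterion (eq_true_of_constant constant_iff_block_join)

namespace Summit.PneNP.PneNP.Theorems.PstarReleaseBlockJoin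

variable {n m : ℕ} {I : LocalMap 4 n m} {r : ℕ} {y : Fin m → Bool} {K : Finset (Fin m)} {w₁ w₂ : Finset (Fin n) × Finset (Fin m) × Bool}
  {s π : Fin n} {g : Fin m}

/-- **ONLY THE RELEASED FORM IS TRANSPARENT.**  Terminal `(K; Γ₁, Γ₂)` on an expanding typed pure instance with simple overlaps; `g ∈ G₂ ∖ G₁`
with AND pair `{s, π}` half-free at `π` (`π` in no output of `K`, in no other monomial of `Γ₁, Γ₂`, `π ∉ C₁`); `s` no XOR variable of `K`,
`s ∉ C₁`, and every partner of `s` in `K ∪ G₁` private (no XOR variable of `K`, not in `C₁`, in no other AND slot of `K ∪ G₁`).  Then `π ∈ C₂`. -/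
theorem mem_linear_of_release (hI : I.IsPure xorAndPred) (hT : Typed I) (hS : SimpleOverlap I) (hB : BoundaryExpanding r I)
    (ht : Terminal I r y K w₁ w₂) (hslots : (I.vars g 2 = s ∧ I.vars g 3 = π) ∨ (I.vars g 2 = π ∧ I.vars g 3 = s)) (hg₂ : g ∈ w₂.2.1)
    (hg₁ : g ∉ w₁.2.1) (hπK : ∀ j ∈ K, π ∉ varSet I j) (hπG : ∀ g' ∈ w₁.2.1 ∪ w₂.2.1, g' ≠ g → I.vars g' 2 ≠ π ∧ I.vars g' 3 ≠ π)
    (hπC₁ : π ∉ w₁.1) (hsX : ∀ j ∈ K, I.vars j 0 ≠ s ∧ I.vars j 1 ≠ s) (hsC : s ∉ w₁.1)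
    (hpart : ∀ j ∈ K ∪ w₁.2.1, ∀ w, (I.vars j 2 = s ∧ I.vars j 3 = w) ∨ (I.vars j 2 = w ∧ I.vars j 3 = s) →
      w ∉ w₁.1 ∧ (∀ j' ∈ K, I.vars j' 0 ≠ w ∧ I.vars j' 1 ≠ w) ∧ ∀ j' ∈ K ∪ w₁.2.1, Through I w j' → j' = j) :
    π ∈ w₂.1 := by
  have hconst : ∀ z, InSlice I y K w₁ z → z s = decide (π ∈ w₂.1) := fun z hz =>
    sigma_eq_of_halfFree hI ht hslots hg₂ hg₁ hπK hπG hπC₁ hz.1 hz.2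
  have hne : ∃ x, InSlice I y K w₁ x := exists_sol_on_target₁ hI hT hS hB ht
  exact of_decide_eq_true (eq_true_of_constant hI hsX hsC hpart hne hconst)

/-- **A TRANSPARENT RELEASE SITS ON A ONE-BLOCK JOIN OF VALUE ONE.**  As in `mem_linear_of_release`, plus: `C₁` reads no AND variable of `K ∪ G₁`
and every output of `K ∪ G₁` not through `s` has a private AND variable.  Then some join `(D ⊆ K, t)` for `C₁`, all of whose members — and, if
`t`, all monomials of `Γ₁` — pass through `s`, has value `Σ_D y + [t]·b₁ = 1`. -/
theorem block_join_of_release (hI : I.IsPure xorAndPred) (hT : Typed I) (hS : SimpleOverlap I) (hB : BoundaryExpanding r I)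
    (ht : Terminal I r y K w₁ w₂) (hslots : (I.vars g 2 = s ∧ I.vars g 3 = π) ∨ (I.vars g 2 = π ∧ I.vars g 3 = s)) (hg₂ : g ∈ w₂.2.1)
    (hg₁ : g ∉ w₁.2.1) (hπK : ∀ j ∈ K, π ∉ varSet I j) (hπG : ∀ g' ∈ w₁.2.1 ∪ w₂.2.1, g' ≠ g → I.vars g' 2 ≠ π ∧ I.vars g' 3 ≠ π)
    (hπC₁ : π ∉ w₁.1) (hsX : ∀ j ∈ K, I.vars j 0 ≠ s ∧ I.vars j 1 ≠ s) (hsC : s ∉ w₁.1)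
    (hC₁ : ∀ v ∈ w₁.1, ∀ j ∈ K ∪ w₁.2.1, ¬ Through I v j)
    (hpart : ∀ j ∈ K ∪ w₁.2.1, ∀ w, (I.vars j 2 = s ∧ I.vars j 3 = w) ∨ (I.vars j 2 = w ∧ I.vars j 3 = s) →
      w ∉ w₁.1 ∧ (∀ j' ∈ K, I.vars j' 0 ≠ w ∧ I.vars j' 1 ≠ w) ∧ ∀ j' ∈ K ∪ w₁.2.1, Through I w j' → j' = j)
    (hfree : ∀ j ∈ K ∪ w₁.2.1, ¬ Through I s j → ∃ p, Through I p j ∧ ∀ j' ∈ K ∪ w₁.2.1, Through I p j' → j' = j) :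
    ∃ D ⊆ K, ∃ t : Bool, IsJoin I w₁.1 D t ∧ (∀ j ∈ D, Through I s j) ∧ (t = true → ∀ g' ∈ w₁.2.1, Through I s g') ∧
      joinValue y w₁.2.2 D t = 1 := by
  have hconst : ∀ z, InSlice I y K w₁ z → z s = decide (π ∈ w₂.1) := fun z hz =>
    sigma_eq_of_halfFree hI ht hslots hg₂ hg₁ hπK hπG hπC₁ hz.1 hz.2
  have hne : ∃ x, InSlice I y K w₁ x := exists_sol_on_target₁ hI hT hS hB ht
  exact (constant_iff_block_join hI hT ht.2.2.2.1 hC₁ hsX hsC hpart hfree hne).1 ⟨_, hconst⟩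

/-- **A RELEASE ON A PRIVATE LITERAL.**  The release gate `g = (p, π)` sits on the AND variable `p` PRIVATE to the member `t ∈ K` (AND pair `{sₜ, p}`;
`p` in no other AND slot of `K ∪ G₁`, no XOR variable of `K`, `p ∉ C₁`), and the shared literal `sₜ` has private partners.  Then `x_{sₜ} ≡ 1` on the
slice and `sₜ` carries a one-block join of value one. -/
theorem block_join_of_release_private (hI : I.IsPure xorAndPred) (hT : Typed I) (hS : SimpleOverlap I) (hB : BoundaryExpanding r I)
    (ht : Terminal I r y K w₁ w₂) {p sₜ : Fin n} {t : Fin m}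
    (hslots : (I.vars g 2 = p ∧ I.vars g 3 = π) ∨ (I.vars g 2 = π ∧ I.vars g 3 = p)) (hg₂ : g ∈ w₂.2.1)
    (hg₁ : g ∉ w₁.2.1) (hπK : ∀ j ∈ K, π ∉ varSet I j) (hπG : ∀ g' ∈ w₁.2.1 ∪ w₂.2.1, g' ≠ g → I.vars g' 2 ≠ π ∧ I.vars g' 3 ≠ π)
    (hπC₁ : π ∉ w₁.1) (htK : t ∈ K) (htslots : (I.vars t 2 = sₜ ∧ I.vars t 3 = p) ∨ (I.vars t 2 = p ∧ I.vars t 3 = sₜ))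
    (hpX : ∀ j ∈ K, I.vars j 0 ≠ p ∧ I.vars j 1 ≠ p) (hpK : ∀ j ∈ K, j ≠ t → I.vars j 2 ≠ p ∧ I.vars j 3 ≠ p) (hpC : p ∉ w₁.1)
    (hpG : ∀ g' ∈ w₁.2.1, I.vars g' 2 ≠ p ∧ I.vars g' 3 ≠ p)
    (hsX : ∀ j ∈ K, I.vars j 0 ≠ sₜ ∧ I.vars j 1 ≠ sₜ) (hsC : sₜ ∉ w₁.1) (hC₁ : ∀ v ∈ w₁.1, ∀ j ∈ K ∪ w₁.2.1, ¬ Through I v j)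
    (hpart : ∀ j ∈ K ∪ w₁.2.1, ∀ w, (I.vars j 2 = sₜ ∧ I.vars j 3 = w) ∨ (I.vars j 2 = w ∧ I.vars j 3 = sₜ) →
      w ∉ w₁.1 ∧ (∀ j' ∈ K, I.vars j' 0 ≠ w ∧ I.vars j' 1 ≠ w) ∧ ∀ j' ∈ K ∪ w₁.2.1, Through I w j' → j' = j)
    (hfree : ∀ j ∈ K ∪ w₁.2.1, ¬ Through I sₜ j → ∃ q, Through I q j ∧ ∀ j' ∈ K ∪ w₁.2.1, Through I q j' → j' = j) :
    (∀ z, InSlice I y K w₁ z → z sₜ = true) ∧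
      ∃ D ⊆ K, ∃ b : Bool, IsJoin I w₁.1 D b ∧ (∀ j ∈ D, Through I sₜ j) ∧ (b = true → ∀ g' ∈ w₁.2.1, Through I sₜ g') ∧
        joinValue y w₁.2.2 D b = 1 := by
  have hconstp : ∀ z : Fin n → Bool, (∀ j ∈ K, I.eval z j = y j) → gval I w₁.1 w₁.2.1 z = w₁.2.2 → z p = decide (π ∈ w₂.1) :=
    fun z hz hz₁ => sigma_eq_of_halfFree hI ht hslots hg₂ hg₁ hπK hπG hπC₁ hz hz₁
  have hconst : ∀ z, InSlice I y K w₁ z → z sₜ = true := fun z hz =>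
    literal_true_of_private_constant hI htK htslots hpX hpK hpC hpG hconstp hz.1 hz.2
  have hne : ∃ x, InSlice I y K w₁ x := exists_sol_on_target₁ hI hT hS hB ht
  exact ⟨hconst, (constant_iff_block_join hI hT ht.2.2.2.1 hC₁ hsX hsC hpart hfree hne).1 ⟨_, hconst⟩⟩

/-- **CONVERSELY: OVER A ONE-BLOCK JOIN OF VALUE ONE THE RELEASED GATE IS ADMISSIBLE.**  A join `(D ⊆ K, t)` through `s` of value one, a fresh
variable `π` (in no output of `K`, not in `C₁, C₂`, in no monomial of `Γ₁, Γ₂`) and an output `g` with AND pair `{s, π}` off `K` and `G₂`, within the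
budget: then `(K; Γ₁, (C₂ + π, G₂ + g, b₂))` is terminal (`PstarMenuRelease.terminal_release_true` with `PstarLiteralPinning.true_of_block_join`). -/
theorem terminal_release_of_block_join (hI : I.IsPure xorAndPred) (ht : Terminal I r y K w₁ w₂) {D : Finset (Fin m)} {t : Bool} (hD : D ⊆ K)
    (hJ : IsJoin I w₁.1 D t) (hDs : ∀ j ∈ D, Through I s j) (hGs : t = true → ∀ g' ∈ w₁.2.1, Through I s g')
    (hval : joinValue y w₁.2.2 D t = 1) (hslots : (I.vars g 2 = s ∧ I.vars g 3 = π) ∨ (I.vars g 2 = π ∧ I.vars g 3 = s))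
    (hπK : ∀ j ∈ K, π ∉ varSet I j) (hπC₁ : π ∉ w₁.1) (hπC₂ : π ∉ w₂.1)
    (hπG : ∀ g' ∈ w₁.2.1 ∪ w₂.2.1, I.vars g' 2 ≠ π ∧ I.vars g' 3 ≠ π) (hgK : g ∉ K) (hgG₂ : g ∉ w₂.2.1)
    (hbudget : (K ∪ w₁.2.1 ∪ insert g w₂.2.1).card ≤ r) :
    Terminal I r y K w₁ (insert π w₂.1, insert g w₂.2.1, w₂.2.2) :=
  terminal_release_true ht hslots (fun _ hx hx₁ => true_of_block_join hI hD hJ hDs hGs hval ⟨hx, hx₁⟩) hπK hπC₁ hπC₂ hπG hgK hgG₂ hbudget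

end Summit.PneNP.PneNP.Theorems.PstarReleaseBlockJoin
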